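import Literature.Algebra.EuclideanDomain.EuclideanOrderTypeAtMostOmega
import Literature.Algebra.EuclideanDomain.LocalPrincipalRingSmallestAlgorithm
import Literature.Algebra.EuclideanDomain.ProductOfEuclideanRings
import Mathlib.Data.ZMod.Basic
import HarnessLib

/-!
# Artinian principal ideal rings are Euclidean, of finite order type (Clark 2015, Cor. 24 and Thm. 23 (b));
# in particular every finite principal ideal ring, e.g. `ℤ/nℤ`

Topic `Literature/Algebra/EuclideanDomain`, namespace `Literature.Algebra.EuclideanDomain`.  THEOREMS ONLY (no `def`, no
instance, no named fact), all proved, in the vocabulary of `TransfiniteSmallestAlgorithm.lean` (`samuelSet R α = A_α`,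
`samuelRank = θ`; «Euclidean» = exhausted by the transfinite construction) and `EuclideanOrderTypeIndecomposable.lean`
(`e(R) = ⨆ z, ((θ z − 1) + 1)`).  Assembles Zariski–Samuel's Theorem 33 (`Literature/RingTheory/PrincipalIdealRing/`:
`bijective_pi_quotient_pow`, special PIRs `exists_isUnit_mul_pow`), Samuel's Prop. 6 for finite products
(`ProductOfEuclideanRings.lean`: `Pi.forall_exists_mem_samuelSet`), the local principal case
(`LocalPrincipalRingSmallestAlgorithm.lean`, whose representation hypothesis `hrep` is now discharged) and Cor. 17 (a)
(`EuclideanOrderTypeAtMostOmega.lean`).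

## Source (read at the page)

P. L. Clark, *A note on Euclidean order types*, Order **32** (2015) 157–178 [Clark2015EuclideanOrderTypes] (materialised
`paper:arxiv-1208.0977`, arXiv numbering; `p0006.txt`–`p0007.txt`), VERBATIM.  **Theorem 23.** «a) (Samuel) Let `R` be a local
principal ring with maximal ideal generated by `π`.  The map `φ : R → Ord` by `uπᵃ ↦ a` is a Euclidean function on `R`.  b) In
fact `φ = φ_R` is the bottom Euclidean function, hence: • If `R` is a domain, `e(R) = ω`. • If `R` is Artinian, then
`e(R) = ℓ(R)`.»  **Corollary 24.** «If `R` is an Artinian principal ring, then `R` is Euclidean and `e(R) = ℓ(R)`, the length of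
`R` as an `R`-module.  Proof. This follows immediately from Theorem 13 [Zariski–Samuel] and Theorem 22 [the Product Theorem].»
(§2.9: «Let `R` be a nonzero local principal ring with maximal ideal `(π)` … Otherwise `R` is Artinian and there is a least
positive integer `a` such that `0 = 1 · πᵃ`; this `a` is nothing else than `ℓ(R)`, the length of `R` as an `R`-module.»)

## What is formalised

* §1 **Thm. 23 for an Artinian LOCAL principal ring, unconditionally**: its maximal ideal is `Rp` with `p` nilpotent, every
  `x ≠ 0` is `u·pᵃ` (special PIRs), so the ring is exhausted by the finite stages of its transfinite construction and
  `e(R)` is the index of nilpotency of `p` — Clark's `ℓ(R)` in the form «the least positive `a` with `πᵃ = 0`»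
  (`forall_exists_mem_samuelSet_of_isLocalRing`, `iSup_samuelRank_eq_nilpotencyClass_of_isLocalRing`).
* §2 **Cor. 24: every Artinian principal ideal ring is Euclidean** — exhausted by its transfinite construction
  (`forall_exists_mem_samuelSet_of_isArtinianRing`: `R ≅ ∏_𝔭 R/𝔭^N`, each factor local Artinian principal, Prop. 6 for the
  product, transport along the isomorphism), of finite Euclidean order type `e(R) < ω`
  (`iSup_samuelRank_lt_omega0_of_isArtinianRing_of_isPrincipalIdealRing`, Cor. 17 (a)), hence Euclidean for an ordinary
  `ℕ`-valued function in Motzkin's and in Samuel's form (`exists_euclideanFunction_of_isArtinianRing`,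
  `exists_algorithm_nat_of_isArtinianRing`).  The identity `e(R) = ℓ(R)` with Mathlib's `Module.length` is NOT formalised
  beyond the local case of §1.
-- TODO(general form): `e(R) = Module.length R R` for a general Artinian PIR (sum over the factors, Clark's Product Theorem).
* §3 every FINITE principal ideal ring is Euclidean with `e < ω` (`forall_exists_mem_samuelSet_of_finite`), e.g. `ℤ/nℤ`,
  `n ≠ 0` (`ZMod.forall_exists_mem_samuelSet`, `ZMod.exists_euclideanFunction`).

## Mathlib / tree search

Mathlib: `IsArtinianRing.isMaximal_of_isPrime`, `isArtinian_of_finite`, `IsLocalRing.maximalIdeal.isMaximal`,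
`IsArtinianRing.isNilpotent_jacobson_bot` (not needed: nilpotency comes from `nilradical = 𝔪` via Theorem 33's exponent),
`ZMod.intCast_surjective`, `IsPrincipalIdealRing.of_surjective`.  Tree: see the header; `lean search 'IsArtinianRing'` in
`Literature/Algebra/EuclideanDomain` → only `EuclideanOrderTypeAtMostOmega.lean` (this generation).
-/

namespace Literature.Algebra.EuclideanDomain

open Ordinal Literature.RingTheory.PrincipalIdealRing

universe u

variable {R : Type u} [CommRing R]

/-! ## §1 Artinian local principal rings (Thm. 23, unconditional) -/

/-- In an Artinian local PRINCIPAL ring the maximal ideal is `Rp` for a nilpotent `p`, and every `x ≠ 0` is `u·pᵃ` with `u` a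
unit — the representation ASSUMED in `LocalPrincipalRingSmallestAlgorithm.lean`, now derived.
[cite: Clark2015EuclideanOrderTypes, §2.9 and Thm. 23 (a)] -/
theorem exists_generator_maximalIdeal_of_isArtinianRing [IsLocalRing R] [IsArtinianRing R] [IsPrincipalIdealRing R] :
    ∃ p : R, IsLocalRing.maximalIdeal R = Ideal.span {p} ∧ IsNilpotent p ∧ ¬ IsUnit p ∧
      ∀ x : R, x ≠ 0 → ∃ (a : ℕ) (u : R), IsUnit u ∧ x = u * p ^ a := by
  obtain ⟨p, hp⟩ := (IsPrincipalIdealRing.principal (IsLocalRing.maximalIdeal R)).principal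
  have hp' : IsLocalRing.maximalIdeal R = Ideal.span {p} := hp
  have hpmem : p ∈ IsLocalRing.maximalIdeal R := hp' ▸ Ideal.mem_span_singleton_self p
  have hpu : ¬ IsUnit p := (IsLocalRing.mem_maximalIdeal p).1 hpmem
  -- `p` lies in every prime (all primes are maximal, hence `= 𝔪`), so `p` is nilpotent
  have hnil : IsNilpotent p := by
    rw [← mem_nilradical, nilradical_eq_sInf, Ideal.mem_sInf]
    intro q hq
    haveI : q.IsPrime := hq
    rw [IsLocalRing.eq_maximalIdeal (IsArtinianRing.isMaximal_of_isPrime q)]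
    exact hpmem
  exact ⟨p, hp', hnil, hpu, exists_isUnit_mul_pow hp' hnil⟩

/-- **An Artinian local principal ring is Euclidean**: its transfinite construction exhausts it (indeed in finitely many
stages). [cite: Clark2015EuclideanOrderTypes, Thm. 23 (a) and Cor. 24] -/
theorem forall_exists_mem_samuelSet_of_isLocalRing [IsLocalRing R] [IsArtinianRing R] [IsPrincipalIdealRing R] :
    ∀ x : R, ∃ α : Ordinal.{u}, x ∈ samuelSet R α := by
  obtain ⟨p, -, -, -, hrep⟩ := exists_generator_maximalIdeal_of_isArtinianRing (R := R)
  exact LocalPrincipal.forall_exists_mem_samuelSet_of_forall_eq_mul_pow hrep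

/-- **Thm. 23 (b), Artinian case, unconditionally: `e(R)` is the index of nilpotency of a generator of the maximal ideal**
(«the least positive integer `a` such that `0 = 1·πᵃ` … is nothing else than `ℓ(R)`»).
[cite: Clark2015EuclideanOrderTypes, Thm. 23 (b) and §2.9] -/
theorem iSup_samuelRank_eq_nilpotencyClass_of_isLocalRing [IsLocalRing R] [IsArtinianRing R] [IsPrincipalIdealRing R]
    {p : R} (hp : IsLocalRing.maximalIdeal R = Ideal.span {p}) :
    (⨆ z : R, (samuelRank z - 1 + 1)) = (nilpotencyClass p : Ordinal.{u}) := by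
  obtain ⟨p', hp', hnil', hpu', hrep'⟩ := exists_generator_maximalIdeal_of_isArtinianRing (R := R)
  -- `p` is nilpotent too (it lies in `𝔪 = nilradical`) and a non-unit
  have hpmem : p ∈ IsLocalRing.maximalIdeal R := hp ▸ Ideal.mem_span_singleton_self p
  have hpu : ¬ IsUnit p := (IsLocalRing.mem_maximalIdeal p).1 hpmem
  have hnil : IsNilpotent p := by
    rw [hp'] at hpmem
    obtain ⟨c, rfl⟩ := Ideal.mem_span_singleton'.1 hpmem
    exact Commute.isNilpotent_mul_left (Commute.all c p') hnil'
  exact LocalPrincipal.iSup_samuelRank_eq_nilpotencyClass hpu (exists_isUnit_mul_pow hp hnil) hnil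

/-! ## §2 Cor. 24: Artinian principal ideal rings are Euclidean -/

/-- **Cor. 24 «If `R` is an Artinian principal ring, then `R` is Euclidean»**: by Zariski–Samuel `R ≅ ∏_𝔭 R/𝔭^N` over its
(maximal) minimal primes, each factor is an Artinian local principal ring, hence Euclidean (§1), a finite product of
Euclidean rings is Euclidean (Samuel's Prop. 6), and an algorithm transports along the isomorphism.
[cite: Clark2015EuclideanOrderTypes, Cor. 24] -/
theorem forall_exists_mem_samuelSet_of_isArtinianRing [IsArtinianRing R] [IsPrincipalIdealRing R] :
    ∀ x : R, ∃ α : Ordinal.{u}, x ∈ samuelSet R α := by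
  obtain ⟨N, hN, hnil⟩ := exists_nilradical_pow_eq_bot (R := R)
  have hN' : N ≠ 0 := Nat.pos_iff_ne_zero.1 hN
  haveI : Finite ↥(minimalPrimes R) := (minimalPrimes.finite_of_isNoetherianRing R).to_subtype
  let e := RingEquiv.ofBijective _ (bijective_pi_quotient_pow (R := R) hnil)
  -- every factor is exhausted
  have hfac : ∀ q : ↥(minimalPrimes R), ∀ y : R ⧸ (q.1 ^ N : Ideal R),
      ∃ α : Ordinal.{u}, y ∈ samuelSet (R ⧸ (q.1 ^ N : Ideal R)) α := by
    intro q
    haveI : q.1.IsPrime := IsMinimalPrime.isPrime q.2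
    have hmax : q.1.IsMaximal := IsArtinianRing.isMaximal_of_isPrime q.1
    haveI := isLocalRing_quotient_pow hmax hN'
    haveI := isArtinianRing_quotient_pow (R := R) hmax hN'
    haveI := isPrincipalIdealRing_quotient (R := R) (q.1 ^ N)
    exact forall_exists_mem_samuelSet_of_isLocalRing
  -- so is the product, and `R` along `e`
  have hpi := Pi.forall_exists_mem_samuelSet hfac
  exact exists_mem_samuelSet_of_algorithm _ (algorithm_comp_ringEquiv_symm e.symm (samuelRank_isAlgorithm hpi))

/-- … of finite Euclidean order type, `e(R) < ω` (Cor. 17 (a)). [cite: Clark2015EuclideanOrderTypes, Cor. 24 and Cor. 17 (a)] -/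
theorem iSup_samuelRank_lt_omega0_of_isArtinianRing_of_isPrincipalIdealRing [IsArtinianRing R] [IsPrincipalIdealRing R] :
    (⨆ z : R, (samuelRank z - 1 + 1)) < ω :=
  iSup_samuelRank_lt_omega0_of_isArtinianRing forall_exists_mem_samuelSet_of_isArtinianRing

/-- … hence Euclidean for an ordinary `ℕ`-valued function (Motzkin's form): all `θ(z)` are finite, so the finite stages exhaust
`R`. [cite: Clark2015EuclideanOrderTypes, Cor. 24] -/
theorem exists_euclideanFunction_of_isArtinianRing [IsArtinianRing R] [IsPrincipalIdealRing R] :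
    ∃ φ : R → ℕ, ∀ a b : R, b ≠ 0 → ∃ q s : R, a = b * q + s ∧ (s = 0 ∨ φ s < φ b) := by
  have h := forall_exists_mem_samuelSet_of_isArtinianRing (R := R)
  refine exists_euclideanFunction_iff_iUnion_samuelSet_natCast.2 (Set.eq_univ_of_forall fun z ↦ ?_)
  obtain ⟨n, hn⟩ := Ordinal.lt_omega0.1 (samuelRank_lt_omega0_of_isArtinianRing h z)
  exact Set.mem_iUnion.2 ⟨n, hn ▸ mem_samuelSet_samuelRank (h z)⟩

/-- … and in Samuel's form (E) with values in `ℕ` (the smallest algorithm itself is finite valued).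
[cite: Clark2015EuclideanOrderTypes, Cor. 24] -/
theorem exists_algorithm_nat_of_isArtinianRing [IsArtinianRing R] [IsPrincipalIdealRing R] :
    ∃ φ : R → ℕ, ∀ a b : R, b ≠ 0 → ∃ q r : R, a = b * q + r ∧ φ r < φ b := by
  classical
  have h := forall_exists_mem_samuelSet_of_isArtinianRing (R := R)
  have hfin : ∀ z : R, ∃ n : ℕ, samuelRank z = n := fun z ↦
    Ordinal.lt_omega0.1 (samuelRank_lt_omega0_of_isArtinianRing h z)
  choose n hn using hfin
  refine ⟨n, fun a b hb ↦ ?_⟩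
  obtain ⟨q, r, hqr, hr⟩ := samuelRank_isAlgorithm h a b hb
  refine ⟨q, r, hqr, ?_⟩
  have : (n r : Ordinal.{u}) < n b := by rw [← hn, ← hn]; exact hr
  exact_mod_cast this

/-! ## §3 Finite principal ideal rings; `ℤ/nℤ` -/

/-- Every FINITE principal ideal ring is Euclidean (exhausted by its transfinite construction), being Artinian.
[cite: Clark2015EuclideanOrderTypes, Cor. 24] -/
theorem forall_exists_mem_samuelSet_of_finite [Finite R] [IsPrincipalIdealRing R] :
    ∀ x : R, ∃ α : Ordinal.{u}, x ∈ samuelSet R α := by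
  haveI : IsArtinianRing R := isArtinian_of_finite
  exact forall_exists_mem_samuelSet_of_isArtinianRing

/-- `ℤ/nℤ` (`n ≠ 0`) is a finite principal ideal ring, hence Euclidean with `e(ℤ/nℤ) < ω`.
[cite: Clark2015EuclideanOrderTypes, Cor. 24] -/
theorem ZMod.forall_exists_mem_samuelSet {n : ℕ} (hn : n ≠ 0) :
    ∀ x : ZMod n, ∃ α : Ordinal.{0}, x ∈ samuelSet (ZMod n) α := by
  haveI : NeZero n := ⟨hn⟩
  haveI : IsPrincipalIdealRing (ZMod n) :=
    IsPrincipalIdealRing.of_surjective (Int.castRingHom (ZMod n)) (ZMod.intCast_surjective)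
  exact forall_exists_mem_samuelSet_of_finite

/-- … and carries an ordinary `ℕ`-valued Euclidean function. [cite: Clark2015EuclideanOrderTypes, Cor. 24] -/
theorem ZMod.exists_euclideanFunction {n : ℕ} (hn : n ≠ 0) :
    ∃ φ : ZMod n → ℕ, ∀ a b : ZMod n, b ≠ 0 → ∃ q s : ZMod n, a = b * q + s ∧ (s = 0 ∨ φ s < φ b) := by
  haveI : NeZero n := ⟨hn⟩
  haveI : IsPrincipalIdealRing (ZMod n) :=
    IsPrincipalIdealRing.of_surjective (Int.castRingHom (ZMod n)) (ZMod.intCast_surjective)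
  haveI : IsArtinianRing (ZMod n) := isArtinian_of_finite
  exact exists_euclideanFunction_of_isArtinianRing

end Literature.Algebra.EuclideanDomain
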